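import Summits.CriticalPhenomena.PercolationContinuityZ3.Theorems.PercNearOneGluingNoHeavyQuantGatedSliceMixLawRegimeBCells
import Summits.CriticalPhenomena.PercolationContinuityZ3.Theorems.PercNearOneGluingNoHeavyQuantGatedSliceMixLawRegimeBTop
import Summits.CriticalPhenomena.PercolationContinuityZ3.Theorems.PercNearOneGluingNoHeavyQuantGatedSliceMixLawRegimeBTwoMidCheap
import Summits.CriticalPhenomena.PercolationContinuityZ3.Theorems.PercNearOneGluingNoHeavyQuantGatedSliceMixLawRegimeBTools
import Summits.CriticalPhenomena.PercolationContinuityZ3.Theorems.PercNearOneGluingNoHeavyQuantGatedSliceMixLawAssembly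
import Summits.CriticalPhenomena.PercolationContinuityZ3.Theorems.PercNearOneGluingNoHeavyQuantGatedSliceMixLawRegimeBOfCells
import Summits.CriticalPhenomena.PercolationContinuityZ3.Theorems.PercNearOneGluingNoHeavyQuantGatedSliceMixLawA5rHolds
import Summits.CriticalPhenomena.PercolationContinuityZ3.Theorems.PercNearOneGluingNoHeavyQuantGatedSliceMixLawPCells
import Summits.CriticalPhenomena.PercolationContinuityZ3.Theorems.PercNearOneGluingNoHeavyQuantGatedSliceMixLawQ4TopMid
import HarnessLib

/-!
# QUANT lane R8, T-DEC, leg (III), blob case — CELL B-M of `LawDec.MixLawRegimeB` (lead g32's hypothesis `hBM` of `mixLawRegimeB_of_cells`,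
# `…QuantGatedSliceMixLawRegimeBOfCells`) FROM ITS RESIDUAL SUB-CELLS: the case analysis dispatching to the census-2 kernel theorems and to
# three typed sub-cells (`MixLawCellPDear`, `MixLawCellPCheap`, `MixLawCellBTopBelow`)

builds on p205010 (kernel theorem, internal audit signed; external expert review pending)

Support file (`--supports stmt-CriticalPhenomena-4575`), QUANT lane seat prim-quant-census-2 (gen 61), rung R8 of
`run/shared/lean/prim/quant/LADDER.md`.  Memo `run/shared/lean/prim/quant/prim-quant-census-2-g61/REGIME-B-TOP-G61.md` §5–§7.  Theorems only,
standard axioms, no sorries.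

THE CELL (lead g32, p352440): the binder of `MixLawRegimeB` plus `2(k₁+a) < t` (the shifted low `ℓ = k₁ + a` is a `t`-low) and `k₂ ≤ j`
(the top is a mid, since `t ≤ 2S ≤ 2k₂`); `MixLawRegimeB = gatedSliceMixLaw_regimeBG ✓ + hBM (this file) + hBL` (`mixLawRegimeB_of_cells`).
THE CASE TREE (`t = S + ag(1−z)`, `U = usage y t j`; `g < 1` from `W_h ∉ D` by `decAtT_weakMidLaw_of_giant`):
  - `k₂ = h`: mid saturated by the lows that prefer it → `gatedSliceMixLaw_regimeB_top_cheap / _top_dear` (KERNEL, `…RegimeBTop`);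
    unsaturated → `MixLawCellPCheap / MixLawCellPDear` (θ = 0, the corrected Q3; arm-2 g36's reduction to the pooled inequality at a raised
    floor + the mean identity + one gap inequality);
  - `k₂ < h`: `k₂` saturated by `ℓ` → `gatedSliceMixLaw_regimeB_twoMid_dear / _cheap`; unsaturated by `ℓ` but saturated with a light `k₁` →
    `…_twoMid_unsat` (KERNEL, `…RegimeBTwoMid`, `…RegimeBTwoMidCheap`); unsaturated → the P-cells;
  - `h < k₂`: saturated → `MixLawCellBTopBelow`; unsaturated → the P-cells.
Branch census of the seat (exact LP / one-mid budget per branch, 6 000 + 45 000 instances): 0 violations of any typed cell.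

* **`LawDec.mixLawCellBM_of_cells`** — `MixLawCellPDear → MixLawCellPCheap → MixLawCellBTopBelow → (hBM)`, the conclusion being lead g32's
  hypothesis `hBM` verbatim.
* **`LawDec.mixLawCellBM_of_topBelow`** — `MixLawCellBTopBelow → (hBM)`, with `MixLawCellPDear` / `MixLawCellPCheap` DISCHARGED by
  `mixLawCellPDear_holds` (arm-3 g116, `…A5rHolds`) and `mixLawCellPCheap_holds` (arm-2 g36, `…PCells`).
* **`LawDec.mixLawRegimeB_of_leaves`** — `MixLawCellBTopBelow → MixLawCellBTwin → MixLawRegimeB`: cell B-L with the top a mid is arm-1 g41's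
  `gatedSliceMixLaw'_cellBL_of_top_le` (θ = 0), with the top a giant it is `MixLawCellBTwin` (arm-2 g36: ⟸ (PI), `mixLawCellBTwin_of_pooled`).
  So `MixLawRegimeB` — hence, with arm-1's Q4/QH/QK, `GatedSliceMixLaw'` (`gatedSliceMixLaw'_of_QcellsB`) — hangs on the two scalar leaves
  `MixLawCellBTopBelow` and (PI).

[this work]; cell map: lead g32, arm-1 g41, arm-3 g64, typer g30 (this lane).  Nothing here is cited as a published result.  The gluing rows served
[cite: KozmaNitzan2024, Conjecture 3 (p. 15)]; product measure [cite: Grimmett1999, §1.3 p. 10].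
-/

noncomputable section

namespace Summit.CriticalPhenomena.PercolationContinuityZ3.Theorems

namespace Quant

open Finset

/-- the two-point law `{lo, hi; g}` (as in `…QuantLawDEC`) -/
local notation3 "TP[" lo ", " hi ", " g ", " h "]" =>
  (g : ℝ) * (if (h : ℕ) = (hi : ℕ) then (1 : ℝ) else 0) + (1 - (g : ℝ)) * (if (h : ℕ) = (lo : ℕ) then (1 : ℝ) else 0)

namespace LawDec

set_option maxHeartbeats 1600000 in
/-- **CELL B-M OF `MixLawRegimeB` FROM ITS RESIDUAL SUB-CELLS** (conclusion = the hypothesis `hBM` of lead g32's `mixLawRegimeB_of_cells`,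
verbatim).  See the file header for the case tree. [this work] -/
theorem mixLawCellBM_of_cells (hPD : MixLawCellPDear) (hPC : MixLawCellPCheap) (hTB : MixLawCellBTopBelow) :
    ∀ (y z g S lam : ℝ) (a j M h k₁ k₂ : ℕ),
      0 < y → y < 1 → 0 ≤ z → z < 1 → g ≤ 1 → y ≤ (1 - z) * g → 1 ≤ a → j < M + a → 0 < S → y * (M : ℝ) ≤ S →
      h ≤ j → h ≤ M → S < (h : ℝ) →
      ¬ DECAtT y (S + (a : ℝ) * g * (1 - z)) j (M + a) (weakMidLaw S g h a) →
      k₁ ≤ k₂ → k₂ ≤ M → 0 ≤ lam → lam ≤ 1 → (1 - z) * ((k₁ : ℝ) + ((k₂ : ℝ) - k₁) * lam) = S →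
      k₁ ≤ j → 2 * (k₁ : ℝ) < S + (a : ℝ) * g * (1 - z) → k₁ + a ≤ j → j + 1 ≤ k₂ + a →
      S + (a : ℝ) * g * (1 - z) ≤ 2 * S → j + 1 ≤ h + a →
      2 * ((k₁ + a : ℕ) : ℝ) < S + (a : ℝ) * g * (1 - z) → k₂ ≤ j →
      ∃ θ : ℝ, 0 ≤ θ ∧ θ < 1 ∧
        DECAtT y (S + (a : ℝ) * g * (1 - z)) j (M + a)
          (fun p => θ * weakMidLaw S g h a p
            + (1 - θ) * (z * (if p = 0 then (1 : ℝ) else 0) + (1 - z) * slice (fun q => TP[k₁, k₂, lam, q]) a g p)) := by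
  intro y z g S lam a j M h k₁ k₂ hy0 hy1 hz0 hz1 hg1 hyg ha hjM hS0 hta hhj hhM hSh hW hk hk₂M hlam0 hlam1 hmean hk₁j hk₁low hlj hk₂aG
    ht2S hhaG hllow hk₂j
  have hSj : S < (j : ℝ) := lt_of_lt_of_le hSh (by exact_mod_cast hhj)
  have hSM : S < (M : ℝ) := lt_of_lt_of_le hSh (by exact_mod_cast hhM)
  have conc := gatedSliceMixLaw_of_decP y z g S lam a j M h k₁ k₂
  have h1z : 0 < 1 - z := by linarith
  have hg0 : 0 < g := by nlinarith
  have h1y : 0 < 1 - y := by linarith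
  have ha0 : (0 : ℝ) ≤ a := Nat.cast_nonneg a
  have hk0 : (0 : ℝ) ≤ k₁ := Nat.cast_nonneg k₁
  have hh0 : (0 : ℝ) < h := lt_trans hS0 hSh
  have hhmid : S + (a : ℝ) * g * (1 - z) ≤ 2 * (h : ℝ) := by linarith
  have hyh : y * (h : ℝ) ≤ S := le_trans (mul_le_mul_of_nonneg_left (by exact_mod_cast hhM) hy0.le) hta
  -- g < 1: otherwise the giant of `W_h` covers its zero and `W_h` is DEC
  have hg1' : g < 1 := by
    by_contra hc
    have hgeq : g = 1 := le_antisymm hg1 (not_lt.1 hc)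
    apply hW
    refine decAtT_weakMidLaw_of_giant y z g S a j M h hy0 hy1 hg0.le hg1 hS0.le hSh hhj hhM hhaG hhmid ?_
    rw [hgeq, mul_one]
    rw [show (1 : ℝ) - S / h = ((h : ℝ) - S) / h by field_simp, show y / (1 - y) * (((h : ℝ) - S) / h) = y * ((h : ℝ) - S) / ((1 - y) * h) by
      field_simp, div_le_div_iff₀ (mul_pos h1y hh0) hh0]
    have hx := mul_nonneg hh0.le (sub_nonneg.2 hyh)
    linarith only [hx]
  -- the top is at least the mean: S ≤ k₂, so k₂ is a mid
  have hk' : (k₁ : ℝ) ≤ k₂ := by exact_mod_cast hk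
  have hSk₂ : S ≤ (k₂ : ℝ) := by
    have e : (k₂ : ℝ) - S = z * k₂ + (1 - z) * (1 - lam) * ((k₂ : ℝ) - k₁) := by rw [← hmean]; ring
    have p1 : 0 ≤ (1 - z) * (1 - lam) * ((k₂ : ℝ) - k₁) := mul_nonneg (mul_nonneg h1z.le (by linarith)) (by linarith)
    have p2 : 0 ≤ z * (k₂ : ℝ) := mul_nonneg hz0 (by linarith)
    linarith only [e, p1, p2]
  have hk₂mid : S + (a : ℝ) * g * (1 - z) ≤ 2 * (k₂ : ℝ) := by linarith
  have hagw_lt : (a : ℝ) * g * (1 - z) < a := by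
    have ha1 : (1 : ℝ) ≤ a := by exact_mod_cast ha
    have : g * (1 - z) < 1 := by nlinarith
    nlinarith
  have hcompk : S + (a : ℝ) * g * (1 - z) < ((k₁ + a : ℕ) : ℝ) + k₂ := by push_cast; linarith
  set t : ℝ := S + (a : ℝ) * g * (1 - z) with ht
  -- compare the top with the weak-mid atom
  rcases lt_trichotomy k₂ h with hlt | heq | hgt
  · -- k₂ < h : two mids, overflow into W's mid
    have hk₂h' : (k₂ : ℝ) < h := by exact_mod_cast hlt
    by_cases hdh : y * ((h : ℝ) - k₁) ≤ t - 2 * (k₁ : ℝ)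
    · -- k₁ dear at h, hence at k₂
      have hdk : y * ((k₂ : ℝ) - k₁) ≤ t - 2 * (k₁ : ℝ) := by
        have : y * (k₂ : ℝ) ≤ y * h := mul_le_mul_of_nonneg_left hk₂h'.le hy0.le
        linarith only [this, hdh]
      by_cases hNl : (1 - z) * lam * (1 - g) ≤ usage y t j (k₁ + a) k₂ * ((1 - z) * (1 - lam) * g)
      · exact gatedSliceMixLaw_regimeB_twoMid_dear y z g S lam a j M h k₁ k₂ hy0 hy1 hz0 hz1 hg1' hyg hS0 hta hhj hhM hSh hk hk₂M hlam0 hlam1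
          hmean hk₁j hk₁low hllow hlj hk₂aG hhaG hk₂j hk₂mid hlt hdh hNl
      · exact conc (hPD y z g S lam a j M k₁ k₂ hy0 hy1 hz0 hz1 hg1 hyg ha hjM hS0 hta hSj hSM hk hk₂M hlam0 hlam1 hmean hk₁j hk₁low hlj hllow
          hk₂j hk₂mid hcompk hk₂aG hdk (not_le.1 hNl).le)
    · have hch : t - 2 * (k₁ : ℝ) ≤ y * ((h : ℝ) - k₁) := (not_le.1 hdh).le
      by_cases hNl : (1 - z) * lam * (1 - g) ≤ usage y t j (k₁ + a) k₂ * ((1 - z) * (1 - lam) * g)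
      · exact gatedSliceMixLaw_regimeB_twoMid_cheap y z g S lam a j M h k₁ k₂ hy0 hy1 hz0 hz1 hg1' hyg hS0 hta hhj hhM hSh hk hk₂M hlam0 hlam1
          hmean hk₁j hk₁low hllow hlj hk₂aG hhaG hk₂j hk₂mid hlt hch hNl
      · have hunsat : usage y t j (k₁ + a) k₂ * ((1 - z) * (1 - lam) * g) ≤ (1 - z) * lam * (1 - g) := (not_le.1 hNl).le
        by_cases hck : t - 2 * (k₁ : ℝ) ≤ y * ((k₂ : ℝ) - k₁)
        · by_cases hsat2 : (1 - z) * lam * (1 - g) ≤ usage y t j (k₁ + a) k₂ * ((1 - z) * (1 - lam) * g)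
              + usage y t j k₁ k₂ * ((1 - z) * (1 - lam) * (1 - g))
          · exact gatedSliceMixLaw_regimeB_twoMid_unsat y z g S lam a j M h k₁ k₂ hy0 hy1 hz0 hz1 hg1' hyg hS0 hta hhj hhM hSh hk hk₂M hlam0
              hlam1 hmean hk₁j hk₁low hllow hlj hk₂aG hhaG hk₂j hk₂mid hlt hck hunsat hsat2
          · exact conc (hPC y z g S lam a j M k₁ k₂ hy0 hy1 hz0 hz1 hg1 hyg ha hjM hS0 hta hSj hSM hk hk₂M hlam0 hlam1 hmean hk₁j hk₁low hlj
              hllow hk₂j hk₂mid hcompk hk₂aG hck (not_le.1 hsat2).le)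
        · exact conc (hPD y z g S lam a j M k₁ k₂ hy0 hy1 hz0 hz1 hg1 hyg ha hjM hS0 hta hSj hSM hk hk₂M hlam0 hlam1 hmean hk₁j hk₁low hlj
            hllow hk₂j hk₂mid hcompk hk₂aG (not_le.1 hck).le hunsat)
  · -- k₂ = h : one mid
    subst heq
    by_cases hch : t - 2 * (k₁ : ℝ) ≤ y * ((k₂ : ℝ) - k₁)
    · by_cases hsat : (1 - z) * lam * (1 - g) ≤ usage y t j (k₁ + a) k₂ * ((1 - z) * (1 - lam) * g)
          + usage y t j k₁ k₂ * ((1 - z) * (1 - lam) * (1 - g))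
      · exact gatedSliceMixLaw_regimeB_top_cheap y z g S lam a j M k₂ k₁ hy0 hy1 hz0 hz1 hg1' hyg hS0 hta hhj hhM hSh hk hlam0 hlam1 hmean
          hk₁j hk₁low hllow hlj hhaG hhmid hch hsat
      · exact conc (hPC y z g S lam a j M k₁ k₂ hy0 hy1 hz0 hz1 hg1 hyg ha hjM hS0 hta hSj hSM hk hk₂M hlam0 hlam1 hmean hk₁j hk₁low hlj
          hllow hk₂j hk₂mid hcompk hk₂aG hch (not_le.1 hsat).le)
    · have hdk : y * ((k₂ : ℝ) - k₁) ≤ t - 2 * (k₁ : ℝ) := (not_le.1 hch).le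
      by_cases hsat : (1 - z) * lam * (1 - g) ≤ usage y t j (k₁ + a) k₂ * ((1 - z) * (1 - lam) * g)
      · exact gatedSliceMixLaw_regimeB_top_dear y z g S lam a j M k₂ k₁ hy0 hy1 hz0 hz1 hg1' hyg hS0 hta hhj hhM hSh hk hlam0 hlam1 hmean
          hk₁j hk₁low hllow hlj hhaG hhmid hdk hsat
      · exact conc (hPD y z g S lam a j M k₁ k₂ hy0 hy1 hz0 hz1 hg1 hyg ha hjM hS0 hta hSj hSM hk hk₂M hlam0 hlam1 hmean hk₁j hk₁low hlj
          hllow hk₂j hk₂mid hcompk hk₂aG hdk (not_le.1 hsat).le)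
  · -- h < k₂ : the weak-mid atom below the top
    by_cases hsat : (1 - z) * lam * (1 - g) ≤ usage y t j (k₁ + a) k₂ * ((1 - z) * (1 - lam) * g)
        ∨ (t - 2 * (k₁ : ℝ) ≤ y * ((k₂ : ℝ) - k₁)
            ∧ (1 - z) * lam * (1 - g) ≤ usage y t j (k₁ + a) k₂ * ((1 - z) * (1 - lam) * g)
                + usage y t j k₁ k₂ * ((1 - z) * (1 - lam) * (1 - g)))
    · exact hTB y z g S lam a j M h k₁ k₂ hy0 hy1 hz0 hz1 hg1 hyg ha hjM hS0 hta hhj hhM hSh hW hk hk₂M hlam0 hlam1 hmean hk₁j hk₁low hlj hk₂aG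
        ht2S hhaG hllow hk₂j hgt hsat
    · push Not at hsat
      obtain ⟨hunsat, hrest⟩ := hsat
      by_cases hck : t - 2 * (k₁ : ℝ) ≤ y * ((k₂ : ℝ) - k₁)
      · exact conc (hPC y z g S lam a j M k₁ k₂ hy0 hy1 hz0 hz1 hg1 hyg ha hjM hS0 hta hSj hSM hk hk₂M hlam0 hlam1 hmean hk₁j hk₁low hlj
          hllow hk₂j hk₂mid hcompk hk₂aG hck (hrest hck).le)
      · exact conc (hPD y z g S lam a j M k₁ k₂ hy0 hy1 hz0 hz1 hg1 hyg ha hjM hS0 hta hSj hSM hk hk₂M hlam0 hlam1 hmean hk₁j hk₁low hlj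
          hllow hk₂j hk₂mid hcompk hk₂aG (not_le.1 hck).le hunsat.le)

/-- **cell B-M from `MixLawCellBTopBelow` alone** (the P-cells discharged: `mixLawCellPDear_holds`, `mixLawCellPCheap_holds`). [this work] -/
theorem mixLawCellBM_of_topBelow (hTB : MixLawCellBTopBelow) :
    ∀ (y z g S lam : ℝ) (a j M h k₁ k₂ : ℕ),
      0 < y → y < 1 → 0 ≤ z → z < 1 → g ≤ 1 → y ≤ (1 - z) * g → 1 ≤ a → j < M + a → 0 < S → y * (M : ℝ) ≤ S →
      h ≤ j → h ≤ M → S < (h : ℝ) →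
      ¬ DECAtT y (S + (a : ℝ) * g * (1 - z)) j (M + a) (weakMidLaw S g h a) →
      k₁ ≤ k₂ → k₂ ≤ M → 0 ≤ lam → lam ≤ 1 → (1 - z) * ((k₁ : ℝ) + ((k₂ : ℝ) - k₁) * lam) = S →
      k₁ ≤ j → 2 * (k₁ : ℝ) < S + (a : ℝ) * g * (1 - z) → k₁ + a ≤ j → j + 1 ≤ k₂ + a →
      S + (a : ℝ) * g * (1 - z) ≤ 2 * S → j + 1 ≤ h + a →
      2 * ((k₁ + a : ℕ) : ℝ) < S + (a : ℝ) * g * (1 - z) → k₂ ≤ j →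
      ∃ θ : ℝ, 0 ≤ θ ∧ θ < 1 ∧
        DECAtT y (S + (a : ℝ) * g * (1 - z)) j (M + a)
          (fun p => θ * weakMidLaw S g h a p
            + (1 - θ) * (z * (if p = 0 then (1 : ℝ) else 0) + (1 - z) * slice (fun q => TP[k₁, k₂, lam, q]) a g p)) :=
  mixLawCellBM_of_cells mixLawCellPDear_holds mixLawCellPCheap_holds hTB

/-- **`MixLawRegimeB` FROM ITS TWO LEAVES**: `MixLawCellBTopBelow` (census-2's cell: the weak-mid atom below a saturated top) and
`MixLawCellBTwin` (the twin not a `t`-low, top a giant; arm-2 g36: ⟸ (PI)); everything else is kernel — cell B-G (lead g32), the P-cells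
(arm-2 g36 / arm-3 g116), the `k₂ = h` and `k₂ < h` mixtures (census-2), and cell B-L with the top a mid (arm-1 g41, θ = 0). [this work] -/
theorem mixLawRegimeB_of_leaves (hTB : MixLawCellBTopBelow) (hTwin : MixLawCellBTwin) : MixLawRegimeB := by
  refine mixLawRegimeB_of_cells (mixLawCellBM_of_topBelow hTB) ?_
  intro y z g S lam a j M h k₁ k₂ hy0 hy1 hz0 hz1 hg1 hyg ha hjM hS0 hta hhj hhM hSh hW hk hk₂M hlam0 hlam1 hmean hk₁j hk₁low hlj hk₂aG
    ht2S hhaG hlmid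
  by_cases hk₂G : j + 1 ≤ k₂
  · exact hTwin y z g S lam a j M h k₁ k₂ hy0 hy1 hz0 hz1 hg1 hyg ha hjM hS0 hta hhj hhM hSh hW hk hk₂M hlam0 hlam1 hmean hk₁j hk₁low hlj
      hk₂aG ht2S hhaG hlmid hk₂G
  · exact gatedSliceMixLaw'_cellBL_of_top_le y z g S lam a j M h k₁ k₂ hy0 hy1 hz0 hz1 hg1 hyg ha hjM hS0 hta hhj hhM hSh hW hk hk₂M hlam0
      hlam1 hmean hk₁j hk₁low hlj hk₂aG ht2S hhaG hlmid (by omega)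

end LawDec

end Quant

end Summit.CriticalPhenomena.PercolationContinuityZ3.Theorems
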